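import Literature.RepresentationTheory.HeisenbergGroup.WeylSystemLatticePairIrreducible
import Literature.MeasureTheory.Integral.L2ProdTensorAmplification
import HarnessLib

/-!
# `(Weyl system on L²(μ)) ⊗ (lattice-pair Heisenberg representation on L²(ν))` is IRREDUCIBLE on `L²(μ ⊗ ν)`
# — the shape of the `L²` model of the adelic `ρ_ψ = ρ_∞ ⊗ ρ_fin`

Topic `RepresentationTheory/HeisenbergGroup`; namespace `Literature.RepresentationTheory.HeisenbergGroup`.  KERNEL ONLY:
theorems; no definition, no named fact, no record, no `sorry`.

[GelbartRogawski1991, §3.1 p. 454 L19–21]: "let `ρ_ψ` be an irreducible unitary representation of `H_𝐀(W)` with central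
character `ψ`".  The natural Hilbert-space MODEL is `L²(X_𝐀) = L²(X_∞ × X_fin)`, on which the archimedean Heisenberg group
acts through the first variable (a Weyl system, [vonNeumann1931], [Folland1989, §1.5]) and the finite-adelic one through
the second (a polarised Heisenberg group with a dual lattice pair, [Weil1964, Chap. III n° 37–39],
[MoeglinVignerasWaldspurger1987, Chap. 2 I.3]).  This file proves the irreducibility of that shape ABSTRACTLY, for
σ-finite measures `μ`, `ν` and the concrete space `E = L²(μ ⊗ ν)` (no Hilbert tensor product; the factors act by the
amplifications of `L2ProdTensorAmplification.lean`):

* §1 **`exists_isWeylSystem_tensor_left`** — a Weyl system `W₁` on `L²(μ)` amplifies to a Weyl system `W = W₁ ⊗ 1` on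
  `L²(μ ⊗ ν)` with `W(x)(f ⊗ g) = W₁(x) f ⊗ g` (relations and strong continuity pass through the total family of tensors);
* §2 **`irreducible_tensor_of_weylSystem_of_latticePair`** — let `W = W₁ ⊗ 1` be such an amplified Weyl system and
  `τ = 1 ⊗ τ₂` the amplification of an isometric `ψ`-representation `τ₂` of `Heisenberg (polar β)` on `L²(ν)` carrying a
  dual lattice pair `(B₁, B₂)`.  If `W₁` has a CYCLIC VACUUM vector `m₁` and `τ₂` a CYCLIC LATTICE-FIXED vector `v₂`
  (both hold as soon as the factors are irreducible), then `L²(μ ⊗ ν)` has no closed subspace invariant under all `W(x)`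
  and all `τ(h)` other than `⊥`, `⊤`.  Proof: `v₀ = m₁ ⊗ v₂` is a `W`-vacuum vector (its diagonal coefficient is
  `γ(z)‖v₀‖²` by `inner_toLp_tensor`, so `mem_vacuumSubspace_of_inner_apply_self`), is `τ`-lattice-fixed, and is jointly
  cyclic (`dense_span_tensor` applied to the two orbits); conclude by `irreducible_of_dense_span_vacuum_latticeFixed`.
* §3 **`irreducible_tensor_of_irreducible`** — the same with the cyclic vectors produced from IRREDUCIBILITY of the factors
  (`exists_vacuumVec_ne_zero` + `dense_span_range_apply_of_irreducible`; `exists_latticeFixed_ne_zero_of_isDualLatticePair` +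
  `Unitary.dense_span_orbit_of_irreducible`): irreducible ⊗ irreducible is irreducible for this shape.

Nothing of the cited sources is asserted; everything is proved from Mathlib and the tree.

## References
* [vonNeumann1931] J. von Neumann, Math. Ann. 104 (1931) 570–578, §5.
* [Folland1989] G. B. Folland, *Harmonic Analysis in Phase Space* (1989), §1.5 Theorem (1.50).
* [Weil1964] A. Weil, Acta Math. 111 (1964), Chap. I n° 11, Chap. III n° 37–39.
* [MoeglinVignerasWaldspurger1987] C. Mœglin, M.-F. Vignéras, J.-L. Waldspurger, LNM 1291 (1987), Chap. 2 I.3, I.6.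
* [ReedSimonI1980] M. Reed, B. Simon, *Methods of Modern Mathematical Physics I* (1980), §II.4 Thm II.10, §VIII.10.
* [GelbartRogawski1991] S. Gelbart, J. Rogawski, Invent. Math. 105 (1991), §3.1 p. 454 L19–21.
-/

set_option autoImplicit false

noncomputable section

open MeasureTheory Complex Filter Set
open scoped InnerProductSpace ComplexConjugate Topology FourierTransform Pointwise
open Literature.MeasureTheory.Integral

namespace Literature.RepresentationTheory.HeisenbergGroup

variable {V : Type*} [NormedAddCommGroup V] [InnerProductSpace ℝ V] [FiniteDimensional ℝ V]
  [MeasurableSpace V] [BorelSpace V]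
variable {X Y : Type*} [MeasurableSpace X] [MeasurableSpace Y] (μ : Measure X) (ν : Measure Y)
  [SigmaFinite μ] [SigmaFinite ν]

namespace IsWeylSystem

variable {J : V →ₗ[ℝ] V} {W₁ : V → Lp ℂ 2 μ →L[ℂ] Lp ℂ 2 μ}

/-! ## §1 Amplifying a Weyl system: `W₁ ⊗ 1` -/

omit [FiniteDimensional ℝ V] [MeasurableSpace V] [BorelSpace V] [SigmaFinite μ] in
/-- each `W₁(x)` as a unitary (inverse `W₁(-x)`). [cite: Folland1989, §1.3 (1.25)–(1.26)] -/
theorem exists_linearIsometryEquiv_eq (hW₁ : IsWeylSystem J W₁) (x : V) :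
    ∃ U : Lp ℂ 2 μ ≃ₗᵢ[ℂ] Lp ℂ 2 μ, ∀ f, U f = W₁ x f := by
  refine ⟨{ toLinearEquiv :=
              LinearEquiv.ofLinear (W₁ x : Lp ℂ 2 μ →ₗ[ℂ] Lp ℂ 2 μ) (W₁ (-x) : Lp ℂ 2 μ →ₗ[ℂ] Lp ℂ 2 μ) ?_ ?_
            norm_map' := hW₁.norm_map x }, fun f => rfl⟩
  · exact LinearMap.ext fun f => hW₁.apply_apply_neg x f
  · exact LinearMap.ext fun f => hW₁.apply_neg_apply x f

omit [FiniteDimensional ℝ V] [MeasurableSpace V] [BorelSpace V] in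
/-- **`W₁ ⊗ 1` is a Weyl system on `L²(μ ⊗ ν)`**: there is `W : V → 𝓑(L²(μ ⊗ ν))` with `W(x)(f ⊗ g) = W₁(x) f ⊗ g`, and it
satisfies the Weyl relations, is isometric and strongly continuous. [cite: vonNeumann1931, §5] -/
theorem exists_isWeylSystem_tensor_left (hW₁ : IsWeylSystem J W₁) :
    ∃ W : V → Lp ℂ 2 (μ.prod ν) →L[ℂ] Lp ℂ 2 (μ.prod ν), IsWeylSystem J W ∧
      ∀ (x : V) (f : Lp ℂ 2 μ) (g : Lp ℂ 2 ν),
        W x ((memLp_tensor_Lp μ ν f g).toLp _) = (memLp_tensor_Lp μ ν (W₁ x f) g).toLp _ := by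
  have hex : ∀ x : V, ∃ T : Lp ℂ 2 (μ.prod ν) ≃ₗᵢ[ℂ] Lp ℂ 2 (μ.prod ν), ∀ (f : Lp ℂ 2 μ) (g : Lp ℂ 2 ν),
      T ((memLp_tensor_Lp μ ν f g).toLp _) = (memLp_tensor_Lp μ ν (W₁ x f) g).toLp _ := by
    intro x
    obtain ⟨U, hU⟩ := hW₁.exists_linearIsometryEquiv_eq μ x
    obtain ⟨T, hT⟩ := exists_linearIsometryEquiv_tensor_left μ ν U
    exact ⟨T, fun f g => by rw [hT, hU]⟩
  choose T hT using hex
  let W : V → Lp ℂ 2 (μ.prod ν) →L[ℂ] Lp ℂ 2 (μ.prod ν) := fun x =>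
    ((T x).toContinuousLinearEquiv : Lp ℂ 2 (μ.prod ν) →L[ℂ] Lp ℂ 2 (μ.prod ν))
  have hWT : ∀ x F, W x F = T x F := fun _ _ => rfl
  refine ⟨W, ?_, fun x f g => by rw [hWT, hT]⟩
  refine ⟨hW₁.inner_J_left, hW₁.norm_J, fun x y F => ?_, fun x F => by rw [hWT]; exact (T x).norm_map F, fun F => ?_⟩
  · -- the Weyl relation, checked on tensors
    have h := clm_eq_of_forall_tensor μ ν ((W x).comp (W y)) ((((𝐞 (⟪x, J y⟫_ℝ / 2) : Circle) : ℂ)) • W (x + y))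
      fun f g => by
        change W x (W y _) = (((𝐞 (⟪x, J y⟫_ℝ / 2) : Circle) : ℂ)) • W (x + y) _
        rw [hWT, hWT, hWT, hT, hT, hT, hW₁.mul, toLp_tensor_smul_left]
    exact congrArg (fun S : Lp ℂ 2 (μ.prod ν) →L[ℂ] Lp ℂ 2 (μ.prod ν) => S F) h
  · -- strong continuity, from the tensors
    refine continuous_apply_of_dense (fun p : Lp ℂ 2 μ × Lp ℂ 2 ν => (memLp_tensor_Lp μ ν p.1 p.2).toLp _)
      (dense_span_tensor_univ μ ν) (fun x => (W x : Lp ℂ 2 (μ.prod ν) →ₗ[ℂ] Lp ℂ 2 (μ.prod ν)))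
      (fun x G => by change ‖W x G‖ = ‖G‖; rw [hWT]; exact (T x).norm_map G) (fun p => ?_) F
    obtain ⟨S, hS⟩ := exists_clm_tensor_left μ ν p.2
    have e : (fun x => (W x : Lp ℂ 2 (μ.prod ν) →ₗ[ℂ] Lp ℂ 2 (μ.prod ν)) ((memLp_tensor_Lp μ ν p.1 p.2).toLp _)) =
        fun x => S (W₁ x p.1) := by
      funext x
      change W x _ = _
      rw [hWT, hT, hS]
    rw [e]
    exact S.continuous.comp (hW₁.continuous p.1)

/-! ## §2 The irreducibility theorem -/

variable {R : Type*} [CommRing R] {Xf Yf : Type*} [AddCommGroup Xf] [Module R Xf] [AddCommGroup Yf] [Module R Yf]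
  [TopologicalSpace Xf] [TopologicalSpace Yf] (β : Xf →ₗ[R] Yf →ₗ[R] R) (ψ : AddChar R Circle)
  {B₁ : AddSubgroup Xf} {B₂ : AddSubgroup Yf}

/-- **irreducibility of `(Weyl system) ⊗ (lattice-pair Heisenberg representation)` on `L²(μ ⊗ ν)`.**  Data: a Weyl
system `W₁` on `L²(μ)` with a CYCLIC VACUUM vector `m₁` (`P m₁ = m₁`, `span {W₁(x) m₁}` dense); a
representation `τ₂` of `Heisenberg (polar β)` on `L²(ν)` with central character `ψ`, a dual lattice pair `(B₁, B₂)` for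
`ψ(β x y)`, and a CYCLIC LATTICE-FIXED vector `v₂`; their amplifications `W = W₁ ⊗ 1` (a Weyl system with
`W(x)(f ⊗ g) = W₁(x) f ⊗ g`) and `τ = 1 ⊗ τ₂` (an isometric representation with `τ(h)(f ⊗ g) = f ⊗ τ₂(h) g`).  Then a
closed subspace of `L²(μ ⊗ ν)` invariant under every `W(x)` and every `τ(h)` is `⊥` or `⊤` — the vector `m₁ ⊗ v₂` is a
`W`-vacuum, `τ`-lattice-fixed, jointly cyclic vector. [cite: vonNeumann1931, §5] -/
theorem irreducible_tensor_of_weylSystem_of_latticePair (hW₁ : IsWeylSystem J W₁)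
    {W : V → Lp ℂ 2 (μ.prod ν) →L[ℂ] Lp ℂ 2 (μ.prod ν)} (hW : IsWeylSystem J W)
    (hWt : ∀ (x : V) (f : Lp ℂ 2 μ) (g : Lp ℂ 2 ν),
      W x ((memLp_tensor_Lp μ ν f g).toLp _) = (memLp_tensor_Lp μ ν (W₁ x f) g).toLp _)
    {m₁ : Lp ℂ 2 μ} (hm₁ : m₁ ∈ hW₁.vacuumSubspace)
    (hd₁ : Dense (Submodule.span ℂ (Set.range fun x : V => W₁ x m₁) : Set (Lp ℂ 2 μ)))
    (τ₂ : Representation ℂ (Heisenberg (polar β)) (Lp ℂ 2 ν))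
    (hτ₂z : ∀ (t : R) (g : Lp ℂ 2 ν),
      τ₂ (Heisenberg.ofCenter (polar β) (Multiplicative.ofAdd t)) g = ((ψ t : Circle) : ℂ) • g)
    (hB : IsDualLatticePair β ψ B₁ B₂) {v₂ : Lp ℂ 2 ν} (hτ₀ : ∀ x ∈ B₁, τ₂ ⟨(x, 0), 0⟩ v₂ = v₂)
    (hμ₀ : ∀ y ∈ B₂, τ₂ ⟨(0, y), 0⟩ v₂ = v₂)
    (hd₂ : Dense (Submodule.span ℂ (Set.range fun h : Heisenberg (polar β) => τ₂ h v₂) : Set (Lp ℂ 2 ν)))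
    (τ : Representation ℂ (Heisenberg (polar β)) (Lp ℂ 2 (μ.prod ν)))
    (hτt : ∀ (h : Heisenberg (polar β)) (f : Lp ℂ 2 μ) (g : Lp ℂ 2 ν),
      τ h ((memLp_tensor_Lp μ ν f g).toLp _) = (memLp_tensor_Lp μ ν f (τ₂ h g)).toLp _)
    (hτu : ∀ (h : Heisenberg (polar β)) (F : Lp ℂ 2 (μ.prod ν)), ‖τ h F‖ = ‖F‖)
    (K : Submodule ℂ (Lp ℂ 2 (μ.prod ν))) (hKc : IsClosed (K : Set (Lp ℂ 2 (μ.prod ν))))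
    (hKW : ∀ (x : V), ∀ F ∈ K, W x F ∈ K) (hKτ : ∀ (h : Heisenberg (polar β)), ∀ F ∈ K, τ h F ∈ K) :
    K = ⊥ ∨ K = ⊤ := by
  set v₀ : Lp ℂ 2 (μ.prod ν) := (memLp_tensor_Lp μ ν m₁ v₂).toLp _ with hv₀
  -- `τ` commutes with `W` and has central character `ψ` (checked on tensors)
  have hτW : ∀ (h : Heisenberg (polar β)) (x : V) (F : Lp ℂ 2 (μ.prod ν)), τ h (W x F) = W x (τ h F) := by
    intro h x F
    obtain ⟨A, hA⟩ := exists_clm_eq_of_norm_eq (τ h) (hτu h)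
    have e := clm_eq_of_forall_tensor μ ν (A.comp (W x)) ((W x).comp A) fun f g => by
      simp only [ContinuousLinearMap.comp_apply, hA, hWt, hτt]
    have := congrArg (fun S : Lp ℂ 2 (μ.prod ν) →L[ℂ] Lp ℂ 2 (μ.prod ν) => S F) e
    simpa only [ContinuousLinearMap.comp_apply, hA] using this
  have hτz : ∀ (t : R) (F : Lp ℂ 2 (μ.prod ν)),
      τ (Heisenberg.ofCenter (polar β) (Multiplicative.ofAdd t)) F = ((ψ t : Circle) : ℂ) • F := by
    intro t F
    obtain ⟨A, hA⟩ := exists_clm_eq_of_norm_eq (τ (Heisenberg.ofCenter (polar β) (Multiplicative.ofAdd t))) (hτu _)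
    have e := clm_eq_of_forall_tensor μ ν A (((ψ t : Circle) : ℂ) • ContinuousLinearMap.id ℂ _) fun f g => by
      change A _ = ((ψ t : Circle) : ℂ) • (memLp_tensor_Lp μ ν f g).toLp _
      rw [hA, hτt, hτ₂z, toLp_tensor_smul_right]
    have h := congrArg (fun S : Lp ℂ 2 (μ.prod ν) →L[ℂ] Lp ℂ 2 (μ.prod ν) => S F) e
    change A F = ((ψ t : Circle) : ℂ) • F at h
    rwa [hA] at h
  -- `v₀` is lattice-fixed
  have hτ₀' : ∀ x ∈ B₁, τ ⟨(x, 0), 0⟩ v₀ = v₀ := fun x hx => by rw [hv₀, hτt, hτ₀ x hx]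
  have hμ₀' : ∀ y ∈ B₂, τ ⟨(0, y), 0⟩ v₀ = v₀ := fun y hy => by rw [hv₀, hτt, hμ₀ y hy]
  -- `v₀` is a `W`-vacuum vector: its diagonal coefficient is Gaussian
  have hv₀M : v₀ ∈ hW.vacuumSubspace := by
    refine hW.mem_vacuumSubspace_of_inner_apply_self fun z => ?_
    -- everything through inner products (no norms): `⟪W₁ z m₁, m₁⟫ ⟪v₂, v₂⟫ = γ(z) ⟪m₁, m₁⟫ ⟪v₂, v₂⟫ = γ(z) ⟪v₀, v₀⟫`
    rw [hv₀, hWt, inner_toLp_tensor, hW₁.inner_apply_of_mem_vacuumSubspace hm₁ hm₁ z, inner_toLp_tensor]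
    ring
  -- joint cyclicity: `W(x) τ(h) v₀ = W₁(x) m₁ ⊗ τ₂(h) v₂` and the tensors of the two dense orbits are dense
  have hd : Dense (Submodule.span ℂ (Set.range fun p : V × Heisenberg (polar β) => W p.1 (τ p.2 v₀)) :
      Set (Lp ℂ 2 (μ.prod ν))) := by
    have e : (fun p : V × Heisenberg (polar β) => W p.1 (τ p.2 v₀)) =
        fun p : V × Heisenberg (polar β) => (memLp_tensor_Lp μ ν (W₁ p.1 m₁) (τ₂ p.2 v₂)).toLp _ := by
      funext p
      rw [hv₀, hτt, hWt]
    rw [e]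
    exact dense_span_tensor μ ν (fun x : V => W₁ x m₁) (fun h : Heisenberg (polar β) => τ₂ h v₂) hd₁ hd₂
  exact hW.irreducible_of_dense_span_vacuum_latticeFixed β ψ τ hτu hτW hτz hτ₀' hμ₀' hd hB hv₀M K hKc hKW hKτ


/-! ## §3 From IRREDUCIBLE factors: cyclic vacuum / lattice-fixed vectors exist -/

omit [FiniteDimensional ℝ V] [MeasurableSpace V] [BorelSpace V] [SigmaFinite μ] in
/-- in an irreducible Weyl system every non-zero vector is cyclic: the closed span of `{W(x) v}` is `W`-invariant
(`W(y) W(x) v = 𝐞(·) W(y + x) v`). [cite: vonNeumann1931, §5] -/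
theorem dense_span_range_apply_of_irreducible (hW₁ : IsWeylSystem J W₁)
    (hirr : ∀ K : Submodule ℂ (Lp ℂ 2 μ), IsClosed (K : Set (Lp ℂ 2 μ)) → (∀ (x : V), ∀ v ∈ K, W₁ x v ∈ K) →
      K = ⊥ ∨ K = ⊤) {v : Lp ℂ 2 μ} (hv : v ≠ 0) :
    Dense (Submodule.span ℂ (Set.range fun x : V => W₁ x v) : Set (Lp ℂ 2 μ)) := by
  set M := Submodule.span ℂ (Set.range fun x : V => W₁ x v) with hM
  rw [Submodule.dense_iff_topologicalClosure_eq_top]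
  have hvM : v ∈ M := Submodule.subset_span ⟨0, by simp only [hW₁.apply_zero]⟩
  have hMW : ∀ (y : V), ∀ u ∈ M, W₁ y u ∈ M := by
    intro y u hu
    induction hu using Submodule.span_induction with
    | mem w hw =>
      obtain ⟨x, rfl⟩ := hw
      rw [hW₁.mul]
      exact Submodule.smul_mem _ _ (Submodule.subset_span ⟨y + x, rfl⟩)
    | zero => rw [map_zero]; exact Submodule.zero_mem _
    | add u u' _ _ hu hu' => rw [map_add]; exact Submodule.add_mem _ hu hu'
    | smul c u _ hu => rw [map_smul]; exact Submodule.smul_mem _ _ hu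
  have hinv : ∀ (y : V), ∀ u ∈ M.topologicalClosure, W₁ y u ∈ M.topologicalClosure := by
    intro y u hu
    rw [← SetLike.mem_coe, Submodule.topologicalClosure_coe] at hu ⊢
    exact closure_mono (Set.image_subset_iff.2 fun w hw => hMW y w hw)
      (image_closure_subset_closure_image (W₁ y).continuous ⟨u, hu, rfl⟩)
  rcases hirr M.topologicalClosure M.isClosed_topologicalClosure hinv with h | h
  · exfalso
    have : v ∈ (⊥ : Submodule ℂ (Lp ℂ 2 μ)) := h ▸ M.le_topologicalClosure hvM
    exact hv ((Submodule.mem_bot ℂ).1 this)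
  · exact h

/-- **irreducible ⊗ irreducible is irreducible, for (Weyl system) ⊗ (lattice-pair Heisenberg representation) on
`L²(μ ⊗ ν)`.**  `W₁` an IRREDUCIBLE Weyl system on `L²(μ) ≠ 0`; `τ₂` an IRREDUCIBLE representation of
`Heisenberg (polar β)` on `L²(ν) ≠ 0` by linear isometries with continuous orbit maps `w ↦ τ₂(w, 0) g` and central
character `ψ`, where `ψ(β x y)` admits a dual lattice pair with unit scalings shrinking to `0` (every finite place; the
finite adèles); `W = W₁ ⊗ 1`, `τ = 1 ⊗ τ₂` their amplifications.  Then `L²(μ ⊗ ν)` has no closed subspace invariant under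
all `W(x)`, `τ(h)` other than `⊥`, `⊤`.  (A non-zero vacuum vector of `W₁` exists, `exists_vacuumVec_ne_zero`, and is
cyclic; a non-zero lattice-fixed vector of `τ₂` exists, `exists_latticeFixed_ne_zero_of_isDualLatticePair`, and is cyclic,
`Unitary.dense_span_orbit_of_irreducible`.)  The shape of "`ρ_∞ ⊗ ρ_fin` is irreducible" for the `L²` model of the adelic
`ρ_ψ`. [cite: GelbartRogawski1991, §3.1 p. 454 L19–21] [cite: vonNeumann1931, §5] -/
theorem irreducible_tensor_of_irreducible [Nontrivial (Lp ℂ 2 μ)] [Nontrivial (Lp ℂ 2 ν)]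
    [IsTopologicalAddGroup Xf] [ContinuousConstSMul R Xf] [IsTopologicalAddGroup Yf] [ContinuousConstSMul R Yf]
    (hW₁ : IsWeylSystem J W₁)
    (h₁i : ∀ K : Submodule ℂ (Lp ℂ 2 μ), IsClosed (K : Set (Lp ℂ 2 μ)) → (∀ (x : V), ∀ v ∈ K, W₁ x v ∈ K) →
      K = ⊥ ∨ K = ⊤)
    {W : V → Lp ℂ 2 (μ.prod ν) →L[ℂ] Lp ℂ 2 (μ.prod ν)} (hW : IsWeylSystem J W)
    (hWt : ∀ (x : V) (f : Lp ℂ 2 μ) (g : Lp ℂ 2 ν),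
      W x ((memLp_tensor_Lp μ ν f g).toLp _) = (memLp_tensor_Lp μ ν (W₁ x f) g).toLp _)
    (τ₂ : Representation ℂ (Heisenberg (polar β)) (Lp ℂ 2 ν))
    (hτ₂u : ∀ (h : Heisenberg (polar β)) (g : Lp ℂ 2 ν), ‖τ₂ h g‖ = ‖g‖)
    (hτ₂c : ∀ g : Lp ℂ 2 ν, Continuous fun w : Xf × Yf => τ₂ ⟨w, 0⟩ g)
    (hτ₂z : ∀ (t : R) (g : Lp ℂ 2 ν),
      τ₂ (Heisenberg.ofCenter (polar β) (Multiplicative.ofAdd t)) g = ((ψ t : Circle) : ℂ) • g)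
    (h₂i : ∀ K : Submodule ℂ (Lp ℂ 2 ν), IsClosed (K : Set (Lp ℂ 2 ν)) →
      (∀ (h : Heisenberg (polar β)), ∀ g ∈ K, τ₂ h g ∈ K) → K = ⊥ ∨ K = ⊤)
    (hB : IsDualLatticePair β ψ B₁ B₂)
    (hX : ∀ N ∈ 𝓝 (0 : Xf), ∃ a : Rˣ, (((a : R) • B₁ : AddSubgroup Xf) : Set Xf) ⊆ N)
    (hY : ∀ N ∈ 𝓝 (0 : Yf), ∃ a : Rˣ, (((a : R) • B₂ : AddSubgroup Yf) : Set Yf) ⊆ N)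
    (τ : Representation ℂ (Heisenberg (polar β)) (Lp ℂ 2 (μ.prod ν)))
    (hτt : ∀ (h : Heisenberg (polar β)) (f : Lp ℂ 2 μ) (g : Lp ℂ 2 ν),
      τ h ((memLp_tensor_Lp μ ν f g).toLp _) = (memLp_tensor_Lp μ ν f (τ₂ h g)).toLp _)
    (hτu : ∀ (h : Heisenberg (polar β)) (F : Lp ℂ 2 (μ.prod ν)), ‖τ h F‖ = ‖F‖)
    (K : Submodule ℂ (Lp ℂ 2 (μ.prod ν))) (hKc : IsClosed (K : Set (Lp ℂ 2 (μ.prod ν))))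
    (hKW : ∀ (x : V), ∀ F ∈ K, W x F ∈ K) (hKτ : ∀ (h : Heisenberg (polar β)), ∀ F ∈ K, τ h F ∈ K) :
    K = ⊥ ∨ K = ⊤ := by
  -- a cyclic vacuum vector of `W₁`
  obtain ⟨u, hu⟩ := hW₁.exists_vacuumVec_ne_zero
  have hm₁ : vacuumVec W₁ u ∈ hW₁.vacuumSubspace := hW₁.vacuumVec_mem_vacuumSubspace u
  have hd₁ := hW₁.dense_span_range_apply_of_irreducible μ h₁i hu
  -- a cyclic lattice-fixed vector of `τ₂`
  obtain ⟨v₂, hv₂0, hτ₀, hμ₀⟩ := exists_latticeFixed_ne_zero_of_isDualLatticePair β ψ τ₂ hB hX hY hτ₂u hτ₂c hτ₂z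
  have hd₂ := Unitary.dense_span_orbit_of_irreducible τ₂ hτ₂u h₂i hv₂0
  exact hW₁.irreducible_tensor_of_weylSystem_of_latticePair μ ν β ψ hW hWt hm₁ hd₁ τ₂ hτ₂z hB hτ₀ hμ₀ hd₂ τ hτt hτu
    K hKc hKW hKτ

end IsWeylSystem

end Literature.RepresentationTheory.HeisenbergGroup

end
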